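import Literature.AlgebraicGeometry.Frobenioids.PrimaryStepsTransport
import HarnessLib

/-!
# Frobenioids I, Theorem 4.2 (ii) (perfect-type case, modulo (i)): the family of bijections
# `Ψ^Prime(A) : Prime(Φ₁(A)) ≅ Prime(Φ₂(Ψ A))` and its compatibility with `Div` of pre-steps to and from `A`

Mochizuki, *The geometry of Frobenioids I: the general theory*, Kyushu J. Math. **62** (2008)
293–400, §4, Theorem 4.2 (ii), kurims text pp. 77–80 [cite: MochizukiFrdI2008, Thm. 4.2 (ii) p.77]:
"`Ψ` induces a bijection `Ψ^Prime(A₁) : Prime(Φ₁(A₁)) ≅ Prime(Φ₂(A₂))` … by thinking … of an element of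
`Prime(Φ_i(A_i))` as an equivalence class of primary steps to or from `A_i` [where the correspondence …
is defined by `Div(−)` — cf. the equivalences of categories of Definition 1.3, (iii), (d)]" (p. 80).

PROVED here, for Frobenioids `C_i → F_{Φ_i}` of PERFECT and isotropic type with `Φ_i` perf-factorial,
and an equivalence `Ψ` such that `Ψ`, `Ψ⁻¹` preserve steps and pre-steps [Thm. 3.4 (ii)] and primary
pre-steps [Thm. 4.2 (i)] — HYPOTHESES, as in `PrimaryStepsTransport.lean` —: there is a UNIQUE family
`e A : Prime(Φ₁(A)) ≃ Prime(Φ₂(Ψ A))` such that, for every prime `𝔭`, (a) a co-angular pre-step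
`φ : A → B` has `Div(φ) ∈ Φ₁(A)_𝔭` iff `Div(Ψ φ) ∈ Φ₂(Ψ A)_{e A 𝔭}`, and (b) a co-angular pre-step
`ψ : B → A` has `ψ_*Div(ψ) ∈ Φ₁(A)_𝔭` iff `Ψ(ψ)_*Div(Ψ ψ) ∈ Φ₂(Ψ A)_{e A 𝔭}` — the body of the typed
statement `PreFrobenioidData.Thm42ii` (seat abc-iut-L1-t3) read in the tree's vocabulary
(`Φ(A)_𝔭 = Primes.submonoid 𝔭`). The reduction of the printed standard-type hypothesis to the
perfect-type case (Prop. 5.5 (iii)) and the discharge of the hypotheses by Thm. 3.4 / Thm. 4.2 (i) are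
not in this file. Composition is diagrammatic; monoids multiplicative. No new definitions.
-/

namespace Literature.AlgebraicGeometry.Frobenioids

open CategoryTheory Opposite

section Monoid

universe w
variable {M : Type w} [CommMonoid M]

/-- `Φ_𝔭 = 𝔭 ∪ {0}` (the representative-free form of `Primes.mem_submonoid_iff`).
[cite: MochizukiFrdI2008, §0 p.12] -/
theorem Primes.mem_submonoid_iff' (𝔭 : Primes M) (c : M) : c ∈ 𝔭.submonoid ↔ c = 1 ∨ c ∈ 𝔭.carrier := by
  obtain ⟨⟨p, hp'⟩, hp⟩ := Quotient.exists_rep 𝔭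
  exact 𝔭.mem_submonoid_iff ⟨hp', hp⟩ c

/-- In a perf-factorial monoid, the product of two primary elements is primary iff they lie in a common
prime (Prop. 4.1 (ii) in the language of monoids, p. 76, and `Φ_𝔭` monoprime).
[cite: MochizukiFrdI2008, Prop. 4.1 (ii) p.76] -/
theorem IsPerfFactorial.isPrimary_mul_iff_exists_common_prime (h : IsPerfFactorial M) {x y : M}
    (hx : IsPrimary x) (hy : IsPrimary y) :
    IsPrimary (x * y) ↔ ∃ 𝔭 : Primes M, x ∈ 𝔭.carrier ∧ y ∈ 𝔭.carrier := by
  constructor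
  · intro hxy
    obtain ⟨z, hz1, hzx, hzy⟩ := h.exists_common_dvd_of_isPrimary_mul hx hxy hy.1 (mul_comm x y)
    exact (h.exists_common_prime_iff hx hy).mpr ⟨z, hz1, hzx, hzy⟩
  · rintro ⟨𝔭, hx𝔭, hy𝔭⟩
    have hmem : x * y ∈ 𝔭.submonoid :=
      mul_mem (Submonoid.subset_closure hx𝔭) (Submonoid.subset_closure hy𝔭)
    rcases (𝔭.mem_submonoid_iff' _).mp hmem with h1 | h1
    · exact absurd (h.isDivisorial.isSharp.eq_one_of_isUnit _ (IsUnit.of_mul_eq_one _ h1)) hx.1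
    · exact h1.1

end Monoid

namespace PreFrobenioid

universe w v v' u u' w₂ v₂ v₂' u₂ u₂'

variable {D : Type u} [Category.{v} D] {Φ : Dᵒᵖ ⥤ CommMonCat.{w}}
  {C : Type u'} [Category.{v'} C] {F : C ⥤ ElemFrobenioid Φ}

/-- A primary pre-step conjugated by isomorphisms is still primary — reflection form.
[cite: MochizukiFrdI2008, Def. 1.2(iii) p.22] -/
theorem IsPrimaryPreStep.of_iso_conj (hP : IsPreFrobenioid Φ F) {X' X Y Y' : C} (e₁ : X' ⟶ X)
    [IsIso e₁] (φ : X ⟶ Y) (e₂ : Y ⟶ Y') [IsIso e₂] (h : IsPrimaryPreStep F (e₁ ≫ φ ≫ e₂)) :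
    IsPrimaryPreStep F φ := by
  have e : φ = inv e₁ ≫ (e₁ ≫ φ ≫ e₂) ≫ inv e₂ := by simp
  rw [e]
  exact (h.comp_iso hP (inv e₂)).iso_comp hP (inv e₁)

/-- A primary pre-step is a step (its zero divisor is not a unit). [cite: MochizukiFrdI2008, Def. 1.2(iii) p.22] -/
theorem IsPrimaryPreStep.isStep (hP : IsPreFrobenioid Φ F) {X Y : C} {φ : X ⟶ Y}
    (h : IsPrimaryPreStep F φ) : IsStep F φ :=
  ⟨h.1, fun _ => h.2.1 (isIsometry_of_isIso F hP φ)⟩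

variable {D₂ : Type u₂} [Category.{v₂} D₂] {Φ₂ : D₂ᵒᵖ ⥤ CommMonCat.{w₂}}
  {C₂ : Type u₂'} [Category.{v₂'} C₂] {F₂ : C₂ ⥤ ElemFrobenioid Φ₂} (Ψ : C ≌ C₂)

set_option backward.isDefEq.respectTransparency false in
/-- `Ψ` reflects primary pre-steps if `Ψ⁻¹` preserves them. [cite: MochizukiFrdI2008, Thm. 4.2 (i) p.77] -/
theorem isPrimaryPreStep_of_map (hP : IsPreFrobenioid Φ F)
    (hprim' : ∀ ⦃X Y : C₂⦄ (φ : X ⟶ Y), IsPrimaryPreStep F₂ φ → IsPrimaryPreStep F (Ψ.inverse.map φ))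
    {X Y : C} {φ : X ⟶ Y} (h : IsPrimaryPreStep F₂ (Ψ.functor.map φ)) : IsPrimaryPreStep F φ := by
  have h1 := hprim' _ h
  rw [Ψ.inv_fun_map] at h1
  exact IsPrimaryPreStep.of_iso_conj hP _ φ _ h1

set_option backward.isDefEq.respectTransparency false in
/-- **Theorem 4.2 (ii), perfect-type case, modulo (i)** (FrdI pp. 77–80): for Frobenioids of perfect and
isotropic type with perf-factorial divisor monoids and an equivalence `Ψ` such that `Ψ`, `Ψ⁻¹` preserve
steps, pre-steps and primary pre-steps (HYPOTHESES = Thm. 3.4 (ii), Thm. 4.2 (i)), there is a UNIQUE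
family of bijections `e A : Prime(Φ₁(A)) ≃ Prime(Φ₂(Ψ A))` such that for every `𝔭 ∈ Prime(Φ₁(A))`:
(a) for every co-angular pre-step `φ : A → B`, `Div(φ) ∈ Φ₁(A)_𝔭 ⟺ Div(Ψ φ) ∈ Φ₂(Ψ A)_{e A 𝔭}`;
(b) for every co-angular pre-step `ψ : B → A`, `ψ_*Div(ψ) ∈ Φ₁(A)_𝔭 ⟺ Ψ(ψ)_*Div(Ψ ψ) ∈ Φ₂(Ψ A)_{e A 𝔭}`
(both memberships written, as in the typed statement, through `Base(−)^*`).
[cite: MochizukiFrdI2008, Thm. 4.2 (ii) p.77] -/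
theorem existsUnique_primesEquiv_family (hF : IsFrobenioid F) (hF₂ : IsFrobenioid F₂)
    (hperf : IsOfPerfectType F) (hperf₂ : IsOfPerfectType F₂)
    (histr : IsOfIsotropicType F) (histr₂ : IsOfIsotropicType F₂)
    (hpf : Objectwise (fun M _ => IsPerfFactorial M) Φ)
    (hpf₂ : Objectwise (fun M _ => IsPerfFactorial M) Φ₂)
    (hstep : ∀ ⦃X Y : C⦄ (φ : X ⟶ Y), IsStep F φ → IsStep F₂ (Ψ.functor.map φ))
    (hstep' : ∀ ⦃X Y : C₂⦄ (φ : X ⟶ Y), IsStep F₂ φ → IsStep F (Ψ.inverse.map φ))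
    (hpre : ∀ ⦃X Y : C⦄ (φ : X ⟶ Y), IsPreStep F φ → IsPreStep F₂ (Ψ.functor.map φ))
    (hpre' : ∀ ⦃X Y : C₂⦄ (φ : X ⟶ Y), IsPreStep F₂ φ → IsPreStep F (Ψ.inverse.map φ))
    (hprim : ∀ ⦃X Y : C⦄ (φ : X ⟶ Y), IsPrimaryPreStep F φ → IsPrimaryPreStep F₂ (Ψ.functor.map φ))
    (hprim' : ∀ ⦃X Y : C₂⦄ (φ : X ⟶ Y), IsPrimaryPreStep F₂ φ → IsPrimaryPreStep F (Ψ.inverse.map φ)) :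
    ∃! e : ∀ A : C, Primes (Φ.obj (op (baseObj F A))) ≃ Primes (Φ₂.obj (op (baseObj F₂ (Ψ.functor.obj A)))),
      ∀ (A : C) (𝔭 : Primes (Φ.obj (op (baseObj F A)))),
        (∀ ⦃B : C⦄ (φ : A ⟶ B), IsCoAngularPreStep F φ →
            (Div F φ ∈ 𝔭.submonoid ↔ Div F₂ (Ψ.functor.map φ) ∈ (e A 𝔭).submonoid)) ∧
        ∀ ⦃B : C⦄ (ψ : B ⟶ A), IsCoAngularPreStep F ψ →
          ((∃ y ∈ 𝔭.submonoid, pull Φ (Base F ψ) y = Div F ψ) ↔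
            ∃ y ∈ (e A 𝔭).submonoid,
              pull Φ₂ (Base F₂ (Ψ.functor.map ψ)) y = Div F₂ (Ψ.functor.map ψ)) := by
  have hP := hF.isPreFrobenioid
  have hP₂ := hF₂.isPreFrobenioid
  have H := fun A : C => existsUnique_primesEquiv Ψ hF hF₂ histr histr₂ hpf hpf₂ hpre hpre' A
    (fun E ε hε => hprim ε hε) (fun Z ξ hξ => hprim' ξ hξ)
  choose e he using fun A => (H A).exists
  -- (b'): the characteristic property, for an arbitrary co-angular pre-step into `A`
  have clauseB : ∀ (A : C) (𝔭 : Primes (Φ.obj (op (baseObj F A)))) ⦃B : C⦄ (ψ : B ⟶ A),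
      IsCoAngularPreStep F ψ →
        ((∃ y ∈ 𝔭.submonoid, pull Φ (Base F ψ) y = Div F ψ) ↔
          ∃ y ∈ (e A 𝔭).submonoid,
            pull Φ₂ (Base F₂ (Ψ.functor.map ψ)) y = Div F₂ (Ψ.functor.map ψ)) := by
    intro A 𝔭 B ψ hψ
    haveI : IsIso (Base F ψ) := hψ.2.2
    have hΨψ : IsPreStep F₂ (Ψ.functor.map ψ) := hpre ψ hψ.2
    haveI : IsIso (Base F₂ (Ψ.functor.map ψ)) := hΨψ.2
    by_cases hiso : IsIso ψ
    · -- both sides hold with `y = 0`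
      refine ⟨fun _ => ⟨1, one_mem _, ?_⟩, fun _ => ⟨1, one_mem _, ?_⟩⟩
      · rw [map_one]; exact (isIsometry_of_isIso F₂ hP₂ (Ψ.functor.map ψ)).symm
      · rw [map_one]; exact (isIsometry_of_isIso F hP ψ).symm
    · have hst : IsStep F ψ := ⟨hψ.2, hiso⟩
      have hst₂ : IsStep F₂ (Ψ.functor.map ψ) := hstep ψ hst
      -- both sides say: `x_ψ` resp. `x_{Ψ ψ}` lies in the prime
      have hL : (∃ y ∈ 𝔭.submonoid, pull Φ (Base F ψ) y = Div F ψ) ↔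
          invDiv F ψ hψ.2.2 ∈ 𝔭.carrier := by
        constructor
        · rintro ⟨y, hy, hyx⟩
          have hy' : y = invDiv F ψ hψ.2.2 :=
            pull_injective_of_isIso Φ (Base F ψ) (by rw [hyx, pull_invDiv])
          rcases (𝔭.mem_submonoid_iff' y).mp hy with h1 | h1
          · exact absurd (by rw [← hyx, h1, map_one]) (div_ne_one_of_isStep histr hst)
          · exact hy' ▸ h1
        · exact fun h => ⟨_, Submonoid.subset_closure h, pull_invDiv ψ hψ.2.2⟩
      have hR : (∃ y ∈ (e A 𝔭).submonoid,
            pull Φ₂ (Base F₂ (Ψ.functor.map ψ)) y = Div F₂ (Ψ.functor.map ψ)) ↔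
          invDiv F₂ (Ψ.functor.map ψ) hΨψ.2 ∈ (e A 𝔭).carrier := by
        constructor
        · rintro ⟨y, hy, hyx⟩
          have hy' : y = invDiv F₂ (Ψ.functor.map ψ) hΨψ.2 :=
            pull_injective_of_isIso Φ₂ (Base F₂ (Ψ.functor.map ψ)) (by rw [hyx, pull_invDiv])
          rcases ((e A 𝔭).mem_submonoid_iff' y).mp hy with h1 | h1
          · exact absurd (by rw [← hyx, h1, map_one]) (div_ne_one_of_isStep histr₂ hst₂)
          · exact hy' ▸ h1
        · exact fun h => ⟨_, Submonoid.subset_closure h, pull_invDiv _ hΨψ.2⟩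
      rw [hL, hR]
      constructor
      · intro h
        exact he A ψ (isPrimaryPreStep_of_isPrimary_invDiv hψ.2 h.1) 𝔭 h
      · intro h
        have hprimψ : IsPrimaryPreStep F ψ :=
          isPrimaryPreStep_of_map Ψ hP hprim' (isPrimaryPreStep_of_isPrimary_invDiv hΨψ h.1)
        let 𝔮 : Primes (Φ.obj (op (baseObj F A))) := Quotient.mk _ ⟨_, isPrimary_invDiv hprimψ⟩
        have hq : invDiv F ψ hψ.2.2 ∈ 𝔮.carrier := mem_carrier_mk_of_isPrimary _
        have h2 := he A ψ hprimψ 𝔮 hq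
        have h3 : e A 𝔮 = e A 𝔭 := Primes.eq_of_mem_carrier h2 h
        rwa [(e A).injective h3] at hq
  -- (a): co-angular pre-steps out of `A`
  have clauseA : ∀ (A : C) (𝔭 : Primes (Φ.obj (op (baseObj F A)))) ⦃B : C⦄ (φ : A ⟶ B),
      IsCoAngularPreStep F φ →
        (Div F φ ∈ 𝔭.submonoid ↔ Div F₂ (Ψ.functor.map φ) ∈ (e A 𝔭).submonoid) := by
    intro A 𝔭 B φ hφ
    by_cases hiso : IsIso φ
    · rw [show Div F φ = 1 from isIsometry_of_isIso F hP φ,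
        show Div F₂ (Ψ.functor.map φ) = 1 from isIsometry_of_isIso F₂ hP₂ _]
      exact ⟨fun _ => one_mem _, fun _ => one_mem _⟩
    have hst : IsStep F φ := ⟨hφ.2, hiso⟩
    have hst₂ : IsStep F₂ (Ψ.functor.map φ) := hstep φ hst
    -- the forward implication, for every prime
    have fwd : ∀ 𝔮 : Primes (Φ.obj (op (baseObj F A))), Div F φ ∈ 𝔮.carrier →
        Div F₂ (Ψ.functor.map φ) ∈ (e A 𝔮).carrier := by
      intro 𝔮 hφ𝔮
      have hφp : IsPrimaryPreStep F φ := ⟨hφ.2, hφ𝔮.1⟩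
      -- a primary step `ε : E → A` in the prime `𝔮`; then `φ ∘ ε` is primary
      obtain ⟨E, ε, hε, hε𝔮⟩ := exists_isPrimaryPreStep_invDiv_mem hF A 𝔮
      haveI : IsIso (Base F ε) := hε.1.2
      have hεst : IsStep F ε := hε.isStep hP
      have hcomp : IsPrimaryPreStep F (ε ≫ φ) := by
        refine ⟨IsPreStep.comp F hε.1 hφ.2, ?_⟩
        rw [div_comp_of_isLinear ε hφ.2.1, ← pull_invDiv ε hε.1.2, ← map_mul]
        exact (isPrimary_pull_iff (Base F ε) _).mpr
          (((hpf _).isPrimary_mul_iff_exists_common_prime hφ𝔮.1 hε𝔮.1).mpr ⟨𝔮, hφ𝔮, hε𝔮⟩)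
      obtain ⟨hc₂, hφ₂⟩ := isPrimaryPreStep_comp_map Ψ hF hF₂ hperf hperf₂ histr histr₂ hpf hpf₂ hstep
        hstep' hpre (fun E' ε' _ hε' => hprim ε' hε') hεst hε hst hcomp hφp
      -- read off the prime of `Div(Ψ φ)` from the primary composite
      have hΨε : IsPrimaryPreStep F₂ (Ψ.functor.map ε) := hprim ε hε
      haveI : IsIso (Base F₂ (Ψ.functor.map ε)) := hΨε.1.2
      have hprod : IsPrimary (Div F₂ (Ψ.functor.map φ) * invDiv F₂ (Ψ.functor.map ε) hΨε.1.2) := by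
        have h1 := hc₂.2
        rw [div_comp_of_isLinear (Ψ.functor.map ε) hφ₂.1.1, ← pull_invDiv (Ψ.functor.map ε) hΨε.1.2,
          ← map_mul] at h1
        exact (isPrimary_pull_iff (Base F₂ (Ψ.functor.map ε)) _).mp h1
      obtain ⟨𝔮₂, hφ𝔮₂, hε𝔮₂⟩ := ((hpf₂ _).isPrimary_mul_iff_exists_common_prime hφ₂.2
        (isPrimary_invDiv hΨε)).mp hprod
      have hε' := he A ε hε 𝔮 hε𝔮
      rwa [Primes.eq_of_mem_carrier hε𝔮₂ hε'] at hφ𝔮₂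
    constructor
    · intro h
      rcases (𝔭.mem_submonoid_iff' _).mp h with h1 | h1
      · exact absurd h1 (div_ne_one_of_isStep histr hst)
      · exact Submonoid.subset_closure (fwd 𝔭 h1)
    · intro h
      rcases ((e A 𝔭).mem_submonoid_iff' _).mp h with h1 | h1
      · exact absurd h1 (div_ne_one_of_isStep histr₂ hst₂)
      · have hφp : IsPrimaryPreStep F φ := isPrimaryPreStep_of_map Ψ hP hprim' ⟨hpre φ hφ.2, h1.1⟩
        let 𝔮 : Primes (Φ.obj (op (baseObj F A))) := Quotient.mk _ ⟨_, hφp.2⟩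
        have hq : Div F φ ∈ 𝔮.carrier := mem_carrier_mk_of_isPrimary _
        have h3 : e A 𝔮 = e A 𝔭 := Primes.eq_of_mem_carrier (fwd 𝔮 hq) h1
        rw [(e A).injective h3] at hq
        exact Submonoid.subset_closure hq
  refine ⟨e, fun A 𝔭 => ⟨clauseA A 𝔭, clauseB A 𝔭⟩, ?_⟩
  -- uniqueness: clause (b) on primary steps into `A` pins down `e A`
  intro e' he'
  funext A
  refine (H A).unique ?_ (he A)
  intro E ε hε 𝔭 hε𝔭
  haveI : IsIso (Base F ε) := hε.1.2
  have hΨε := hprim ε hε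
  haveI : IsIso (Base F₂ (Ψ.functor.map ε)) := hΨε.1.2
  have hco : IsCoAngularPreStep F ε :=
    ⟨isCoAngular_of_isIsotropic_codomains F ε fun Z _ => histr Z, hε.1⟩
  obtain ⟨y, hy, hyx⟩ := ((he' A 𝔭).2 ε hco).mp ⟨_, Submonoid.subset_closure hε𝔭, pull_invDiv ε hε.1.2⟩
  have hy' : y = invDiv F₂ (Ψ.functor.map ε) hΨε.1.2 :=
    pull_injective_of_isIso Φ₂ (Base F₂ (Ψ.functor.map ε)) (by rw [hyx, pull_invDiv])
  rcases ((e' A 𝔭).mem_submonoid_iff' y).mp hy with h1 | h1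
  · exact absurd (by rw [← hyx, h1, map_one])
      (div_ne_one_of_isStep histr₂ (hstep ε (hε.isStep hP)))
  · exact hy' ▸ h1

end PreFrobenioid

end Literature.AlgebraicGeometry.Frobenioids
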